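import Mathlib
import Literature.Analysis.FluidPDE.VectorCalculus
import Summits.NavierStokesRegularity.NavierStokesRegularity.Theorems.ThreadingFluxCentreJetDefs
import Summits.NavierStokesRegularity.NavierStokesRegularity.Theorems.ThreadingFluxSilentShellsTwoAxesTools
import Summits.NavierStokesRegularity.NavierStokesRegularity.Theorems.ThreadingFluxPlatonicDefs
import HarnessLib

/-!
# Crux `PoloidalLiouville` (stmt-NavierStokesRegularity-1222, W1) / `UnthreadedRigidity` (stmt-…-27585, W2), crux idea
# «platonic-germ-sieve» (ns-idea-15 g11, V27): the symmetry algebra of an O-equivariant field — tools for the W2 glue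

Support file (Theorems-side; seat ns-wall-eng-8 g6, cell `ns-wall-extremal`; `--supports stmt-NavierStokesRegularity-1222 --as helper`;
0 kit).  Elementary `ℝ³` calculus behind `Theorems/ThreadingFluxPlatonicWindowGlue.lean` (the sketch's paper-only W2 wiring
`UnthreadedRigidity → SymmetricWindowRigidity octahedral`), over the Defs twin `ThreadingFluxPlatonicDefs.lean`:

* `Platonic.fderiv_cross_of_equivariant` — TRANSPORT: if a differentiable field `W` commutes with a cross-product-preserving
  surjective linear map `g` (`W ∘ g = g ∘ W`) and is infinitesimally rotation-equivariant about the axial vector `c`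
  (`DW(x)[c × x] = c × W(x)` for all `x`), then it is so about `g c`;
* the three coordinate half-turns and the coordinate 3-cycle are ROTATIONS OF THE CUBE (`IsCubeRotationData`), are linear,
  surjective and preserve cross products (`cubeRot_halfTurn_*`, `cubeRot_cycle_*`);
* `Platonic.fderiv_cross_all_of_octahedral` — SPANNING: an O-equivariant differentiable field that is infinitesimally
  rotation-equivariant about ONE non-zero axial vector is so about EVERY vector (the O-orbit of a non-zero vector spans `ℝ³`:
  half-turns isolate the coordinates `aᵢeᵢ`, the 3-cycle moves a non-zero one around);
* `Platonic.eq_zero_of_fderiv_cross_all` — RADIAL LEMMA: a `C¹` divergence-free field on `ℝ³` with `DW(x)[c × x] = c × W(x)` for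
  all `c, x` vanishes identically.  Proof without division or limits: `c = x` gives `x × W(x) = 0`, hence `‖x‖² W = m·x` with
  `m = ⟪W, x⟫`; taking divergences, `2m = Dm(x)[x] + 3m`, so `s ↦ s·m(s x)` has zero derivative on `ℝ` and `m(x) = 0·m(0) = 0`;
  continuity removes the origin.

Helper lemmas only; no Prop of the sketch is restated; `UnthreadedRigidity` (27585), `PoloidalLiouville` (1222) and NS regularity are
OPEN and NOT touched.  [folklore]
-/

-- the summit and its single sub-problem share the name (CONVENTIONS §1)
set_option linter.dupNamespace false

noncomputable section

open Set Function Filter Metric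
open scoped RealInnerProductSpace Topology
open Literature.Analysis.FluidPDE
open Summit.NavierStokesRegularity.NavierStokesRegularity.Theorems.PoloidalLiouville.CentreJet (E3)
open Summit.NavierStokesRegularity.NavierStokesRegularity.Theorems.PoloidalLiouville.SilentShells (TwoAxes.divergence_smul_id)

namespace Summit.NavierStokesRegularity.NavierStokesRegularity.Theorems.PoloidalLiouville.Platonic

/-! ### Cross-product bookkeeping -/

/-- BAC−CAB with a vanishing inner cross product: if `x × w = 0` then `‖x‖² w = ⟪w, x⟫ x`. -/
theorem norm_sq_smul_eq_of_cross_eq_zero {x w : E3} (h : cross x w = 0) : (‖x‖ ^ 2) • w = ⟪w, x⟫ • x := by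
  have h0 := congrArg (fun v : E3 => v 0) h
  have h1 := congrArg (fun v : E3 => v 1) h
  have h2 := congrArg (fun v : E3 => v 2) h
  simp [cross, crossProduct] at h0 h1 h2
  -- h0 : x₁w₂ − x₂w₁ = 0, h1 : x₂w₀ − x₀w₂ = 0, h2 : x₀w₁ − x₁w₀ = 0 (up to normalisation)
  rw [EuclideanSpace.real_norm_sq_eq]
  ext i
  fin_cases i <;> simp [PiLp.inner_apply, Fin.sum_univ_three]
  · linear_combination (-(x 1)) * h2 + (x 2) * h1
  · linear_combination (x 0) * h2 - (x 2) * h0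
  · linear_combination (-(x 0)) * h1 + (x 1) * h0

/-! ### Infinitesimal rotation-equivariance is linear in the axial vector and transported by symmetries -/

/-- Linearity in the axial vector of the identity `DW(x)[c × x] = c × W(x)`. -/
theorem fderiv_cross_lincomb {W : E3 → E3} {c₁ c₂ : E3} (h₁ : ∀ x, fderiv ℝ W x (cross c₁ x) = cross c₁ (W x))
    (h₂ : ∀ x, fderiv ℝ W x (cross c₂ x) = cross c₂ (W x)) (a b : ℝ) (x : E3) :
    fderiv ℝ W x (cross (a • c₁ + b • c₂) x) = cross (a • c₁ + b • c₂) (W x) := by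
  -- bilinearity in the axial vector (the tree's `ForcedTsai.cross_add_smul_left` pattern, inlined)
  have hlin : ∀ y : E3, cross (a • c₁ + b • c₂) y = a • cross c₁ y + b • cross c₂ y := fun y => by
    ext i; fin_cases i <;> simp [cross, crossProduct]
  rw [hlin, hlin, map_add, map_smul, map_smul, h₁ x, h₂ x]

/-- **Transport.**  `W` differentiable, `W ∘ g = g ∘ W` for a linear `g` (given as a continuous linear map `L`) that is surjective and
preserves cross products; then `DW(x)[c × x] = c × W(x)` for all `x` implies the same for the axial vector `g c`. -/
theorem fderiv_cross_of_equivariant {W : E3 → E3} (hW : Differentiable ℝ W) (L : E3 →L[ℝ] E3)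
    (hsurj : Function.Surjective L) (hcross : ∀ u v : E3, L (cross u v) = cross (L u) (L v))
    (hequi : ∀ x, W (L x) = L (W x)) {c : E3} (hc : ∀ x, fderiv ℝ W x (cross c x) = cross c (W x)) (y : E3) :
    fderiv ℝ W y (cross (L c) y) = cross (L c) (W y) := by
  obtain ⟨x, rfl⟩ := hsurj y
  -- chain rule on `W ∘ L = L ∘ W`
  have hcomp : HasFDerivAt (fun z => W (L z)) ((fderiv ℝ W (L x)).comp L) x :=
    (hW (L x)).hasFDerivAt.comp x L.hasFDerivAt
  have hcomp' : HasFDerivAt (fun z => L (W z)) (L.comp (fderiv ℝ W x)) x :=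
    L.hasFDerivAt.comp x (hW x).hasFDerivAt
  have hfun : (fun z => W (L z)) = fun z => L (W z) := funext hequi
  rw [hfun] at hcomp
  have hD : (fderiv ℝ W (L x)).comp L = L.comp (fderiv ℝ W x) := hcomp.unique hcomp'
  have hDv : ∀ v, fderiv ℝ W (L x) (L v) = L (fderiv ℝ W x v) := fun v => by
    simpa using congrArg (fun T : E3 →L[ℝ] E3 => T v) hD
  rw [← hcross, hDv, hc x, hcross, hequi]

/-! ### Four rotations of the cube: the coordinate half-turns and the coordinate 3-cycle -/

/-- `cubeRot σ s` is additive. -/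
theorem cubeRot_add (σ : Equiv.Perm (Fin 3)) (s : Fin 3 → ℝ) (x y : E3) :
    cubeRot σ s (x + y) = cubeRot σ s x + cubeRot σ s y := by
  ext i; simp [cubeRot]; ring

/-- `cubeRot σ s` is homogeneous. -/
theorem cubeRot_smul (σ : Equiv.Perm (Fin 3)) (s : Fin 3 → ℝ) (a : ℝ) (x : E3) :
    cubeRot σ s (a • x) = a • cubeRot σ s x := by
  ext i; simp [cubeRot]; ring

/-- `cubeRot σ s` as a continuous linear map. -/
theorem exists_clm_cubeRot (σ : Equiv.Perm (Fin 3)) (s : Fin 3 → ℝ) :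
    ∃ L : E3 →L[ℝ] E3, ∀ x, L x = cubeRot σ s x := by
  have hlin : IsLinearMap ℝ (cubeRot σ s) := ⟨cubeRot_add σ s, cubeRot_smul σ s⟩
  exact ⟨LinearMap.toContinuousLinearMap (hlin.mk' _), fun x => rfl⟩

/-- The half-turn about `e₀`: `(x₀, x₁, x₂) ↦ (x₀, −x₁, −x₂)` is a rotation of the cube. -/
theorem isCubeRotationData_halfTurn₀ : IsCubeRotationData 1 ![1, -1, -1] :=
  ⟨by intro i; fin_cases i <;> simp, by simp [Fin.prod_univ_three]⟩

/-- The half-turn about `e₁` is a rotation of the cube. -/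
theorem isCubeRotationData_halfTurn₁ : IsCubeRotationData 1 ![-1, 1, -1] :=
  ⟨by intro i; fin_cases i <;> simp, by simp [Fin.prod_univ_three]⟩

/-- The half-turn about `e₂` is a rotation of the cube. -/
theorem isCubeRotationData_halfTurn₂ : IsCubeRotationData 1 ![-1, -1, 1] :=
  ⟨by intro i; fin_cases i <;> simp, by simp [Fin.prod_univ_three]⟩

/-- The coordinate 3-cycle `(x₀, x₁, x₂) ↦ (x₁, x₂, x₀)` is a rotation of the cube. -/
theorem isCubeRotationData_cycle : IsCubeRotationData (finRotate 3) (fun _ => 1) :=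
  ⟨by intro i; simp, by simp [sign_finRotate]⟩

/-- Coordinates of the 3-cycle. -/
theorem cubeRot_cycle_apply (x : E3) :
    cubeRot (finRotate 3) (fun _ => 1) x = WithLp.toLp 2 ![x 1, x 2, x 0] := by
  ext i
  fin_cases i <;> simp [cubeRot]

/-- Half-turns preserve cross products. -/
theorem cubeRot_halfTurn₀_cross (u v : E3) :
    cubeRot 1 ![1, -1, -1] (cross u v) = cross (cubeRot 1 ![1, -1, -1] u) (cubeRot 1 ![1, -1, -1] v) := by
  ext i; fin_cases i <;> simp [cubeRot, cross, crossProduct] <;> ring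

/-- Half-turns preserve cross products. -/
theorem cubeRot_halfTurn₁_cross (u v : E3) :
    cubeRot 1 ![-1, 1, -1] (cross u v) = cross (cubeRot 1 ![-1, 1, -1] u) (cubeRot 1 ![-1, 1, -1] v) := by
  ext i; fin_cases i <;> simp [cubeRot, cross, crossProduct] <;> ring

/-- Half-turns preserve cross products. -/
theorem cubeRot_halfTurn₂_cross (u v : E3) :
    cubeRot 1 ![-1, -1, 1] (cross u v) = cross (cubeRot 1 ![-1, -1, 1] u) (cubeRot 1 ![-1, -1, 1] v) := by
  ext i; fin_cases i <;> simp [cubeRot, cross, crossProduct] <;> ring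

/-- The 3-cycle preserves cross products. -/
theorem cubeRot_cycle_cross (u v : E3) :
    cubeRot (finRotate 3) (fun _ => 1) (cross u v) =
      cross (cubeRot (finRotate 3) (fun _ => 1) u) (cubeRot (finRotate 3) (fun _ => 1) v) := by
  rw [cubeRot_cycle_apply, cubeRot_cycle_apply, cubeRot_cycle_apply]
  ext i; fin_cases i <;> simp [cross, crossProduct]

/-- A half-turn (`σ = 1`, signs `±1`) is an involution, hence surjective. -/
theorem cubeRot_one_surjective {s : Fin 3 → ℝ} (hs : ∀ i, s i = 1 ∨ s i = -1) :
    Function.Surjective (cubeRot 1 s) := by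
  intro y
  refine ⟨cubeRot 1 s y, ?_⟩
  ext i
  have hsi : s i * s i = 1 := by rcases hs i with h | h <;> simp [h]
  simp [cubeRot]
  rw [← mul_assoc, hsi, one_mul]

/-- The 3-cycle is surjective (its square is its inverse). -/
theorem cubeRot_cycle_surjective : Function.Surjective (cubeRot (finRotate 3) (fun _ => (1 : ℝ))) := by
  intro y
  refine ⟨WithLp.toLp 2 ![y 2, y 0, y 1], ?_⟩
  rw [cubeRot_cycle_apply]
  ext i; fin_cases i <;> rfl

/-! ### Spanning: the O-orbit of a non-zero vector -/

set_option linter.unnecessarySeqFocus false in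
/-- **Spanning.**  If `W` is differentiable, O-equivariant, and infinitesimally rotation-equivariant about ONE non-zero axial vector
`a`, then `DW(x)[c × x] = c × W(x)` for EVERY `c`.  (The set of good `c` is a subspace stable under the rotations of the cube; the
half-turns isolate `aᵢ eᵢ` from `a`, one `aᵢ` is non-zero, and the 3-cycle carries `eᵢ` to the other two coordinate vectors.) -/
theorem fderiv_cross_all_of_octahedral {W : E3 → E3} (hW : Differentiable ℝ W) (hequi : IsEquivariant octahedral W)
    {a : E3} (ha : a ≠ 0) (hPa : ∀ x, fderiv ℝ W x (cross a x) = cross a (W x)) :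
    ∀ c x : E3, fderiv ℝ W x (cross c x) = cross c (W x) := by
  -- the property and its closure rules
  set P : E3 → Prop := fun c => ∀ x, fderiv ℝ W x (cross c x) = cross c (W x) with hP
  have hlin : ∀ (r t : ℝ) (c₁ c₂ : E3), P c₁ → P c₂ → P (r • c₁ + t • c₂) :=
    fun r t c₁ c₂ h₁ h₂ x => fderiv_cross_lincomb h₁ h₂ r t x
  have hsmul : ∀ (r : ℝ) (c : E3), P c → P (r • c) := by
    intro r c h
    have := hlin r 0 c c h h
    simpa using this
  -- stability under a rotation of the cube given by data `(σ, s)` with the three structural facts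
  have hstab : ∀ (σ : Equiv.Perm (Fin 3)) (s : Fin 3 → ℝ), IsCubeRotationData σ s →
      Function.Surjective (cubeRot σ s) →
      (∀ u v : E3, cubeRot σ s (cross u v) = cross (cubeRot σ s u) (cubeRot σ s v)) →
      ∀ c, P c → P (cubeRot σ s c) := by
    intro σ s hd hsurj hcross c hc
    obtain ⟨L, hL⟩ := exists_clm_cubeRot σ s
    have hsurjL : Function.Surjective L := by
      intro y; obtain ⟨x, hx⟩ := hsurj y; exact ⟨x, by rw [hL, hx]⟩
    have hcrossL : ∀ u v : E3, L (cross u v) = cross (L u) (L v) := fun u v => by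
      rw [hL, hL, hL, hcross]
    have hequiL : ∀ x, W (L x) = L (W x) := fun x => by
      rw [hL, hL]; exact hequi _ ⟨σ, s, hd, rfl⟩ x
    have h := fderiv_cross_of_equivariant hW L hsurjL hcrossL hequiL hc
    rw [hL] at h
    exact h
  have h₀ : P (cubeRot 1 ![1, -1, -1] a) :=
    hstab _ _ isCubeRotationData_halfTurn₀ (cubeRot_one_surjective isCubeRotationData_halfTurn₀.1) cubeRot_halfTurn₀_cross a hPa
  have h₁ : P (cubeRot 1 ![-1, 1, -1] a) :=
    hstab _ _ isCubeRotationData_halfTurn₁ (cubeRot_one_surjective isCubeRotationData_halfTurn₁.1) cubeRot_halfTurn₁_cross a hPa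
  have h₂ : P (cubeRot 1 ![-1, -1, 1] a) :=
    hstab _ _ isCubeRotationData_halfTurn₂ (cubeRot_one_surjective isCubeRotationData_halfTurn₂.1) cubeRot_halfTurn₂_cross a hPa
  -- the coordinate pieces `aᵢ eᵢ = ½ a + ½ (half-turn a)`
  set e : Fin 3 → E3 := fun i => EuclideanSpace.single i (1 : ℝ) with he
  have hpiece : ∀ i : Fin 3, P (a i • e i) := by
    intro i
    fin_cases i
    · have h := hlin (1 / 2) (1 / 2) _ _ hPa h₀
      convert h using 1
      ext j; fin_cases j <;> simp [he, cubeRot] <;> ring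
    · have h := hlin (1 / 2) (1 / 2) _ _ hPa h₁
      convert h using 1
      ext j; fin_cases j <;> simp [he, cubeRot] <;> ring
    · have h := hlin (1 / 2) (1 / 2) _ _ hPa h₂
      convert h using 1
      ext j; fin_cases j <;> simp [he, cubeRot] <;> ring
  -- one coordinate of `a` is non-zero, so one coordinate vector is good
  have hex : ∃ i : Fin 3, a i ≠ 0 := by
    by_contra hcon
    push Not at hcon
    exact ha (by ext i; simp [hcon i])
  obtain ⟨i, hi⟩ := hex
  have hei : P (e i) := by
    have h := hsmul (a i)⁻¹ _ (hpiece i)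
    rwa [smul_smul, inv_mul_cancel₀ hi, one_smul] at h
  -- the 3-cycle carries it to the other two
  have hcyc : ∀ c, P c → P (cubeRot (finRotate 3) (fun _ => 1) c) :=
    hstab _ _ isCubeRotationData_cycle cubeRot_cycle_surjective cubeRot_cycle_cross
  have hcyc_e : ∀ j : Fin 3, cubeRot (finRotate 3) (fun _ => (1 : ℝ)) (e j) = e (j + 2) := by
    intro j
    rw [cubeRot_cycle_apply]
    fin_cases j <;> (ext k; fin_cases k <;> simp [he])
  have hall_e : ∀ j : Fin 3, P (e j) := by
    have h1 : P (e (i + 2)) := by rw [← hcyc_e]; exact hcyc _ hei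
    have h2 : P (e (i + 2 + 2)) := by rw [← hcyc_e]; exact hcyc _ h1
    intro j
    have hj : j = i ∨ j = i + 2 ∨ j = i + 2 + 2 := by
      fin_cases i <;> fin_cases j <;> simp
    rcases hj with rfl | rfl | rfl
    · exact hei
    · exact h1
    · exact h2
  -- every vector
  intro c
  have hc : c = (c 0 • e 0 + c 1 • e 1) + c 2 • e 2 := by
    ext j; fin_cases j <;> simp [he]
  have h01 : P (c 0 • e 0 + c 1 • e 1) := hlin _ _ _ _ (hall_e 0) (hall_e 1)
  have h : P ((1 : ℝ) • (c 0 • e 0 + c 1 • e 1) + c 2 • e 2) := hlin _ _ _ _ h01 (hall_e 2)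
  rw [one_smul] at h
  rw [hc]
  exact h

/-! ### The radial lemma -/

/-- `div (c T) = c div T + Dc(T)` (Leibniz rule at a point; re-proved to keep imports light). -/
theorem divergence_smul_apply' {c : E3 → ℝ} {T : E3 → E3} {x : E3} (hc : DifferentiableAt ℝ c x)
    (hT : DifferentiableAt ℝ T x) :
    VectorCalculus.divergence (fun y => c y • T y) x = c x * VectorCalculus.divergence T x + fderiv ℝ c x (T x) := by
  let b := stdOrthonormalBasis ℝ E3
  rw [divergence_eq_sum_inner_fderiv b, divergence_eq_sum_inner_fderiv b, fderiv_fun_smul hc hT, Finset.mul_sum]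
  simp only [_root_.add_apply, _root_.FunLike.coe_smul, Pi.smul_apply,
    ContinuousLinearMap.smulRight_apply, inner_add_right, Finset.sum_add_distrib, real_inner_smul_right]
  congr 1
  calc ∑ i, fderiv ℝ c x (b i) * ⟪b i, T x⟫
      = fderiv ℝ c x (∑ i, ⟪b i, T x⟫ • b i) := by simp [mul_comm]
    _ = fderiv ℝ c x (T x) := by rw [b.sum_repr']

/-- **Radial lemma.**  A `C¹` divergence-free field on `ℝ³` which is infinitesimally equivariant under EVERY rotation,
`DW(x)[c × x] = c × W(x)` for all `c, x`, vanishes identically.  (No division, no limit: `‖x‖² W = m x` with `m = ⟪W, x⟫`,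
`Dm(x)[x] = −m(x)` from the two divergences, so `s ↦ s·m(s x)` is constant on `ℝ`, whence `m = 0`; continuity handles `x = 0`.) -/
theorem eq_zero_of_fderiv_cross_all {W : E3 → E3} (hW : ContDiff ℝ 1 W) (hdiv : VectorCalculus.IsDivFree W)
    (hall : ∀ c x : E3, fderiv ℝ W x (cross c x) = cross c (W x)) : W = 0 := by
  have hWd : Differentiable ℝ W := hW.differentiable one_ne_zero
  have hWc : Continuous W := hW.continuous
  -- (a) `x × W x = 0`
  have hxW : ∀ x, cross x (W x) = 0 := fun x => by
    have h := hall x x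
    have hxx : cross x x = 0 := by ext i; fin_cases i <;> simp [cross, crossProduct] <;> ring
    rwa [hxx, map_zero, eq_comm] at h
  -- (b) `‖x‖² W x = m x • x`, `m = ⟪W, id⟫`
  set m : E3 → ℝ := fun x => ⟪W x, x⟫ with hm
  have hmd : Differentiable ℝ m := hWd.inner ℝ differentiable_id
  have hrad : ∀ x, (‖x‖ ^ 2) • W x = m x • x := fun x => norm_sq_smul_eq_of_cross_eq_zero (hxW x)
  -- (c) `Dm(x)[x] = −m x`, comparing the divergences of the two sides
  have hDm : ∀ x, fderiv ℝ m x x = -m x := by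
    intro x
    have hfun : (fun y : E3 => (‖y‖ ^ 2) • W y) = fun y => m y • y := funext hrad
    have hn : DifferentiableAt ℝ (fun y : E3 => ‖y‖ ^ 2) x := (differentiableAt_id.norm_sq ℝ)
    have hL : VectorCalculus.divergence (fun y : E3 => (‖y‖ ^ 2) • W y) x = 2 * m x := by
      rw [divergence_smul_apply' hn (hWd x), hdiv x, mul_zero, zero_add]
      have hD : fderiv ℝ (fun y : E3 => ‖y‖ ^ 2) x = 2 • innerSL ℝ x := (hasStrictFDerivAt_norm_sq x).hasFDerivAt.fderiv
      rw [hD]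
      simp [hm, real_inner_comm]
    have hR : VectorCalculus.divergence (fun y : E3 => m y • y) x = fderiv ℝ m x x + 3 * m x :=
      TwoAxes.divergence_smul_id (hmd x)
    rw [hfun, hR] at hL
    linarith
  -- (d) `s ↦ s · m (s x)` is constant, so `m x = 0`
  have hm0 : ∀ x, m x = 0 := by
    intro x
    have hline : ∀ s : ℝ, HasDerivAt (fun s : ℝ => s • x) x s := fun s => by
      simpa using (hasDerivAt_id s).smul_const x
    have hφd : ∀ s : ℝ, HasDerivAt (fun r : ℝ => r * m (r • x)) (m (s • x) + s * fderiv ℝ m (s • x) x) s := by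
      intro s
      have hm' : HasFDerivAt m (fderiv ℝ m (s • x)) (s • x) := (hmd (s • x)).hasFDerivAt
      have h1' := hm'.comp_hasDerivAt s (hline s)
      have h1 : HasDerivAt (fun r : ℝ => m (r • x)) (fderiv ℝ m (s • x) x) s := h1'
      have h2 : HasDerivAt (fun r : ℝ => r * m (r • x)) (1 * m (s • x) + s * fderiv ℝ m (s • x) x) s :=
        (hasDerivAt_id' s).fun_mul h1
      simpa using h2
    have hφ0 : ∀ s : ℝ, deriv (fun r : ℝ => r * m (r • x)) s = 0 := by
      intro s
      rw [(hφd s).deriv]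
      have hs : s * fderiv ℝ m (s • x) x = fderiv ℝ m (s • x) (s • x) := by
        rw [map_smul, smul_eq_mul]
      rw [hs, hDm]
      ring
    have hconst := is_const_of_deriv_eq_zero (fun s => (hφd s).differentiableAt) hφ0 1 0
    simpa using hconst
  -- (e) `W = 0` off the origin, and at the origin by continuity
  have hoff : ∀ x : E3, x ≠ 0 → W x = 0 := by
    intro x hx
    have h := hrad x
    rw [hm0 x, zero_smul] at h
    have hx2 : (‖x‖ ^ 2 : ℝ) ≠ 0 := by positivity
    exact (smul_eq_zero.1 h).resolve_left hx2
  have hdense : Dense ({0}ᶜ : Set E3) := dense_compl_singleton 0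
  have heq : EqOn W 0 ({0}ᶜ : Set E3) := fun x hx => hoff x hx
  exact Continuous.ext_on hdense hWc continuous_const heq

end Summit.NavierStokesRegularity.NavierStokesRegularity.Theorems.PoloidalLiouville.Platonic

end
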